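import Summits.BirchSwinnertonDyer.BirchSwinnertonDyer.Theorems.KolyvaginDepthDoorKNSupplyLevelOneStructure
import HarnessLib

/-!
# Route `KolyvaginDepthDoor`, crux `KolyvaginDepthSupplyKN` (stmt-BirchSwinnertonDyer-22820) —
# the level-one supply per `(E, p, K)` FROM A MOD-`p` STRUCTURE STATEMENT (no Hypothesis ♠ (2)):
# the form in which the ♠ (2)-residual stub of line `levelone` is consumed (skeleton v5)

Helper file of the lead prover (kdd-p1 g12; `--supports stmt-BirchSwinnertonDyer-22820 --as helper`);
route-independent (no `Theses` import); it closes nothing and BSD is not proved by it.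

`levelOne_kolyvaginClass_rankClause_of_lemma84` (g11, file `KolyvaginDepthDoorKNSupplyLevelOneStructure`)
derives the crux's level-one class with the SIGNED rank clause from W. Zhang's Lemma 8.4 (1) / Thm. 9.1
taken BY NAME — a fact whose hypotheses include Hypothesis ♠ (2), false on the residual class (non-CM,
`N_E` not square-free, fewer than two multiplicative primes). Its proof uses only the SHAPE of Zhang's
conclusion at the given `(E, p, K)`: a level-one class `c_1(n) ≠ 0`, `n ∈ Λ`, with
`#Sel_p(E/ℚ) = p^{ν(n)+1}` or `#Sel_p(E^{(d_K)}/ℚ) = p^{ν(n)+1}` (Zhang's `dim Sel_p^{ε_ν}(E/K) = ν + 1`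
read on the eigenspaces `Sel_p(E/K)^± = Sel_p(E/ℚ), Sel_p(E^{(d_K)}/ℚ)`, sign forgotten). This file
isolates that step:

* `levelOne_kolyvaginClass_rankClause_of_structure` — per `(E, p, K)`: the structure statement (as a
  hypothesis `hstr`, no ♠ at all) + `Ш(E)[p] = 0` + `Ш(E^{(d_K)})[p] = 0` + `rank E^{(d_K)} ≤ 1` ⟹ a
  level-one class with the crux's signed clause (exact descent counts `#Sel_p = p^{rank}`, AEC X.4.2,
  `E[p]` irreducible from `ρ̄` onto; no parity theorem).
* `structure_of_lemma84` — W. Zhang's fact BY NAME (on the ♠ cell) implies the structure statement.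

So the residual stub of the skeleton can be stated as the bare mod-`p` structure statement at `(E, p, K)`
— the shape of W. Zhang 2014 Lemma 8.4 (1) + Thm. 9.1 WITHOUT Hypothesis ♠ (2), which is what
Burungale–Castella–Grossi–Skinner 2026 Thm. 2 (`𝓜_∞ = ord_p Tam_E`, no square-free hypothesis) with
Zanarella 2019 §2 (primitivity ⟹ the mod-`p` class generates the Selmer line at every core vertex)
deliver in print — and the line's composition does the rest. UNCONDITIONAL; BSD is not proved by this.

References: [WZhang2014] Lemma 8.4 (1) (p. 236), Thm. 9.1 (p. 240); [SilvermanAEC2009] Thm. X.4.2;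
[BurungaleEtAl2026] Thm. 2; [Zanarella2019] Cor. 2.14, Lemma 2.16, Prop. 2.18 (arXiv:1908.09197).
-/

set_option linter.dupNamespace false

noncomputable section

open scoped Classical NumberField

namespace Summit.BirchSwinnertonDyer.BirchSwinnertonDyer.Theorems.KolyvaginDepthDoor

open Literature.NumberTheory.EllipticCurves Literature.NumberTheory.EllipticCurves.ModularForms
  WeierstrassCurve

/-- **The level-one supply per `(E, p, K)` from a MOD-`p` STRUCTURE STATEMENT (no Hypothesis ♠).**
`E/ℚ` elliptic globally minimal (`a_ℓ` is read on `W`), `p` prime with `ρ̄_{E,p}` onto, `K` imaginary quadratic (any number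
field with `d_K ≠ 0` would do for the algebra). IF (structure, hypothesis `hstr`: the shape of
W. Zhang 2014 Lemma 8.4 (1) + Thm. 9.1 at this `(E, p, K)`) there are a frame `(Dt, β, ι)`, a
square-free product `n` of Kolyvagin primes and a datum `d` of conductor `n` with `c_1(n) ≠ 0` and
`#Sel_p(E/ℚ) = p^{ν(n)+1}` OR `#Sel_p(E^{(d_K)}/ℚ) = p^{ν(n)+1}`, and IF `Ш(E/ℚ)[p] = 0`,
`Ш(E^{(d_K)}/ℚ)[p] = 0` and `rank E^{(d_K)}(ℚ) ≤ 1`, THEN that class satisfies the SIGNED rank clause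
of the crux: `ν(n)+1 ≤ rank E(ℚ) ∨ (ν(n) ≤ rank E(ℚ) ∧ ν(n)+1 ≤ rank E^{(d_K)}(ℚ))`. Proof: the exact
descent counts `#Sel_p(E) = p^{rank E}`, `#Sel_p(E^{(d_K)}) = p^{rank E^{(d_K)}}` (AEC X.4.2 with
`Ш[p] = 0` and `E[p]`, `E^{(d_K)}[p]` irreducible, `natCard_selmerGroup_eq_pow_rank_of_sha_inf_torsionBy_eq_bot`)
turn the dichotomy into `ν + 1 = rank E` (first clause) or `ν + 1 = rank E^{(d_K)} ≤ 1`, `ν = 0` (second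
clause). No parity theorem. UNCONDITIONAL. [cite: WZhang2014, Lemma 8.4 (1) (p. 236)]
[cite: SilvermanAEC2009, Thm. X.4.2] -/
theorem levelOne_kolyvaginClass_rankClause_of_structure
    (W : WeierstrassCurve ℚ) [W.IsElliptic] [W.IsGloballyMinimal] (p : ℕ) [hp : Fact p.Prime]
    (hsurj : W.HasSurjectiveModNGaloisRep p)
    (K : Type) [Field K] [NumberField K] {N : ℕ} [NeZero N]
    (hstr : ∃ (Dt : ModularParametrizationData W N) (β : ℤ) (ι : K →+* ℂ) (n : ℕ)
      (d : KolyvaginHeegnerData Dt β ι n),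
      KolyvaginDescent.KolSupp (Zhang2014.IsKolyvaginPrime N W K p) n ∧
        d.kolyvaginClass hp.out 1 ≠ 0 ∧
        (Nat.card (W.selmerGroup p) = p ^ (n.primeFactors.card + 1) ∨
          Nat.card ((W.quadraticTwist (NumberField.discr K : ℚ)).selmerGroup p) =
            p ^ (n.primeFactors.card + 1)))
    (hshaW : (W.sha ⊓ AddSubgroup.torsionBy W.galH1 (p : ℤ) : AddSubgroup W.galH1) = ⊥)
    (hshaT : ((W.quadraticTwist (NumberField.discr K : ℚ)).sha ⊓
        AddSubgroup.torsionBy (W.quadraticTwist (NumberField.discr K : ℚ)).galH1 (p : ℤ) :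
        AddSubgroup (W.quadraticTwist (NumberField.discr K : ℚ)).galH1) = ⊥)
    (hT1 : (W.quadraticTwist (NumberField.discr K : ℚ)).mordellWeilRank ≤ 1) :
    ∃ (Dt : ModularParametrizationData W N) (β : ℤ) (ι : K →+* ℂ) (n : ℕ)
      (d : KolyvaginHeegnerData Dt β ι n),
      KolyvaginDescent.KolSupp (Zhang2014.IsKolyvaginPrime N W K p) n ∧
        d.kolyvaginClass hp.out 1 ≠ 0 ∧
        (n.primeFactors.card + 1 ≤ W.mordellWeilRank ∨
          (n.primeFactors.card ≤ W.mordellWeilRank ∧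
            n.primeFactors.card + 1 ≤ (W.quadraticTwist (NumberField.discr K : ℚ)).mordellWeilRank)) := by
  obtain ⟨Dt, β, ι, n, d, hsupp, hne, hdich⟩ := hstr
  have hpP : p.Prime := hp.out
  have h2p : 2 ≤ p := hpP.two_le
  haveI : NeZero (p : ℚ) := ⟨by exact_mod_cast hpP.ne_zero⟩
  -- irreducibility of `E[p]` and of the twist's `E^{(d_K)}[p] ≅ E[p] ⊗ χ`
  have hirr : W.HasIrreducibleModPGaloisRep p :=
    hasIrreducibleModPGaloisRep_of_hasSurjectiveModNGaloisRep W p hsurj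
  have hdK : (NumberField.discr K : ℚ) ≠ 0 := by exact_mod_cast NumberField.discr_ne_zero K
  haveI := W.isElliptic_quadraticTwist hdK
  have hirrT : (W.quadraticTwist (NumberField.discr K : ℚ)).HasIrreducibleModPGaloisRep p :=
    (W.hasIrreducibleModPGaloisRep_quadraticTwist_iff hdK p).mpr hirr
  -- the two descent counts
  have hSelW : Nat.card (W.selmerGroup p) = p ^ W.mordellWeilRank :=
    natCard_selmerGroup_eq_pow_rank_of_sha_inf_torsionBy_eq_bot W p hirr hshaW
  have hSelT : Nat.card ((W.quadraticTwist (NumberField.discr K : ℚ)).selmerGroup p) =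
      p ^ (W.quadraticTwist (NumberField.discr K : ℚ)).mordellWeilRank :=
    natCard_selmerGroup_eq_pow_rank_of_sha_inf_torsionBy_eq_bot _ p hirrT hshaT
  refine ⟨Dt, β, ι, n, d, hsupp, hne, ?_⟩
  rcases hdich with hW1 | hT1'
  · -- the non-zero class sits on the `E` side: `rank E = ν + 1`
    left
    rw [hSelW] at hW1
    have := Nat.pow_right_injective h2p hW1
    omega
  · -- it sits on the twist side: `rank E^{(d_K)} = ν + 1 ≤ 1`, so `ν = 0`
    right
    rw [hSelT] at hT1'
    have := Nat.pow_right_injective h2p hT1'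
    constructor <;> omega

/-- **Zhang's fact BY NAME gives the structure statement** (bookkeeping: the named fact
`WZhang2014_lemma84_exists_minimal_kolyvaginClass_one_selmerCard` at `(E, p, K)` on W. Zhang's
Hypothesis-♠ cell implies the hypothesis `hstr` of `levelOne_kolyvaginClass_rankClause_of_structure`,
forgetting `1 ≤ M(n)`, the minimality of `ν(n)` and the `≤` halves of the dichotomy). CONDITIONAL on
`h84`. [cite: WZhang2014, Lemma 8.4 (1) (p. 236), Thm. 9.1 (p. 240)] -/
theorem structure_of_lemma84
    (h84 : Literature.NumberTheory.EllipticCurves.WZhang2014_lemma84_exists_minimal_kolyvaginClass_one_selmerCard)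
    (W : WeierstrassCurve ℚ) [W.IsElliptic] [W.IsGloballyMinimal] (p : ℕ) [hp : Fact p.Prime]
    (h5 : 5 ≤ p) (hgood : W.HasGoodReductionAtPrime p) (hord : ¬ (p : ℤ) ∣ W.frobeniusTrace p)
    (hsurj : W.HasSurjectiveModNGaloisRep p)
    (hS1 : ∀ (ℓ : ℕ) [Fact ℓ.Prime], W.HasMultiplicativeReductionAtPrime ℓ →
      ¬ p ∣ padicValInt ℓ W.minimalDiscriminantInt)
    (hS2 : ¬ Squarefree (W.conductorNorm ℤ) →
      (∃ (ℓ : ℕ) (_ : Fact ℓ.Prime), W.HasMultiplicativeReductionAtPrime ℓ ∧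
          ¬ p ∣ padicValInt ℓ W.minimalDiscriminantInt) ∧
        ∃ (ℓ₁ ℓ₂ : ℕ) (_ : Fact ℓ₁.Prime) (_ : Fact ℓ₂.Prime), ℓ₁ ≠ ℓ₂ ∧
          W.HasMultiplicativeReductionAtPrime ℓ₁ ∧ W.HasMultiplicativeReductionAtPrime ℓ₂)
    (K : Type) [Field K] [NumberField K] (hK : IsImaginaryQuadratic K)
    (hpD : ¬ ((p : ℤ) ∣ NumberField.discr K))
    (hDN : IsCoprime (NumberField.discr K) ((W.conductorNorm ℤ : ℕ) : ℤ))
    [NeZero (W.conductorNorm ℤ)] (hHeeg : SatisfiesHeegnerHypothesis (W.conductorNorm ℤ) K) :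
    ∃ (Dt : ModularParametrizationData W (W.conductorNorm ℤ)) (β : ℤ) (ι : K →+* ℂ) (n : ℕ)
      (d : KolyvaginHeegnerData Dt β ι n),
      KolyvaginDescent.KolSupp (Zhang2014.IsKolyvaginPrime (W.conductorNorm ℤ) W K p) n ∧
        d.kolyvaginClass hp.out 1 ≠ 0 ∧
        (Nat.card (W.selmerGroup p) = p ^ (n.primeFactors.card + 1) ∨
          Nat.card ((W.quadraticTwist (NumberField.discr K : ℚ)).selmerGroup p) =
            p ^ (n.primeFactors.card + 1)) := by
  obtain ⟨Dt, β, ι, n, d, hsupp, -, hne, -, hdich⟩ :=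
    h84 W p h5 hgood hord hsurj hS1 hS2 K hK hpD hDN hHeeg
  refine ⟨Dt, β, ι, n, d, hsupp, hne, ?_⟩
  rcases hdich with ⟨hW1, -⟩ | ⟨hT1, -⟩
  · exact Or.inl hW1
  · exact Or.inr hT1

end Summit.BirchSwinnertonDyer.BirchSwinnertonDyer.Theorems.KolyvaginDepthDoor

end
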